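import Mathlib.Analysis.Complex.JensenFormula
import Mathlib.Analysis.Complex.CauchyIntegral

/-!
# Jensen count of real zeros of an entire function of exponential type

Helper file for item stmt-RiemannHypothesis-1043 (`StrictUnderRH`, route WeilWindowFlow): the
elementary half of the "uniqueness set" argument. If `F` is entire, `F(c) ≠ 0` at a real point `c`,
and `‖F(z)‖ ≤ K e^{B |Im z|}` (`K ≥ 1`, `B ≥ 0`; e.g. the Fourier–Laplace transform of an `L¹`
function on `[-B, B]`), then every finite set of real zeros of `F` in `[c - r, c + r]` has at most
`(log K + 2 B r - log ‖F(c)‖) / log 2` elements: Jensen's inequality (Mathlib's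
`AnalyticOnNhd.sum_divisor_le`) on the discs of radii `r < 2r` about `c`, each zero carrying
divisor `≥ 1` because `F ≢ 0`. In particular the real zeros of such an `F` have at most linear
counting function, with slope `2B / log 2`.

No definitions, no named facts; Mathlib only.
-/

-- `Summit.RiemannHypothesis.RiemannHypothesis.…` repeats a namespace component by design (D-0017 layout).
set_option linter.dupNamespace false

noncomputable section

open Complex Filter Set Metric MeromorphicOn
open scoped Topology

namespace Summit.RiemannHypothesis.RiemannHypothesis.Theorems.WeilWindowFlowStrictUnderRH

/-- An entire function which is not identically zero has finite, positive vanishing order at each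
of its zeros: if `F` is differentiable on `ℂ`, `F c ≠ 0` for some `c`, and `F x = 0`, then the
divisor of `F` on any set `U ∋ x` is `≥ 1` at `x`. [folklore] -/
theorem one_le_divisor_of_zero {F : ℂ → ℂ} (hF : Differentiable ℂ F) {c : ℂ} (hc : F c ≠ 0)
    {U : Set ℂ} {x : ℂ} (hxU : x ∈ U) (hx : F x = 0) :
    1 ≤ divisor F U x := by
  have han : AnalyticOnNhd ℂ F U := fun z _ ↦ hF.analyticAt z
  have hax : AnalyticAt ℂ F x := hF.analyticAt x
  rw [han.divisor_apply hxU]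
  have hne_top : analyticOrderAt F x ≠ ⊤ := by
    intro htop
    have hall : AnalyticOnNhd ℂ F univ := fun z _ ↦ hF.analyticAt z
    have h0 : EqOn F 0 univ :=
      hall.eqOn_zero_of_preconnected_of_eventuallyEq_zero isPreconnected_univ (mem_univ x)
        (analyticOrderAt_eq_top.mp htop)
    exact hc (h0 (mem_univ c))
  have hne_zero : analyticOrderAt F x ≠ 0 := by
    rw [Ne, hax.analyticOrderAt_eq_zero]
    exact fun h ↦ h hx
  obtain ⟨n, hn⟩ := ENat.ne_top_iff_exists.mp hne_top
  rw [← hn] at hne_zero ⊢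
  rw [ENat.map_coe, WithTop.untop₀_coe]
  have hn0 : n ≠ 0 := fun h ↦ hne_zero (by simp [h])
  exact_mod_cast Nat.one_le_iff_ne_zero.mpr hn0

/-- **Jensen count of real zeros of an entire function of exponential type.** Let `F` be entire
with `‖F z‖ ≤ K · exp (B |Im z|)` for all `z` (`1 ≤ K`, `0 ≤ B`), and let `c ∈ ℝ` with
`F c ≠ 0`. Then for every `r > 0`, every finite set `S` of real zeros of `F` with `|x - c| ≤ r`
satisfies `#S ≤ (log K + B · 2r - log ‖F c‖) / log 2`. Proof: Jensen's inequality
(`AnalyticOnNhd.sum_divisor_le`) on the discs `|z - c| ≤ r < 2r`, where `|Im z| ≤ 2r` on the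
outer circle, and each zero has divisor `≥ 1` (`one_le_divisor_of_zero`). [folklore] -/
theorem card_real_zeros_le {F : ℂ → ℂ} (hF : Differentiable ℂ F) {c : ℝ} (hc : F c ≠ 0)
    {K B : ℝ} (hK : 1 ≤ K) (hB : 0 ≤ B) (hbound : ∀ z : ℂ, ‖F z‖ ≤ K * Real.exp (B * |z.im|))
    {r : ℝ} (hr : 0 < r) (S : Finset ℝ) (hS : ∀ x ∈ S, |x - c| ≤ r ∧ F x = 0) :
    (S.card : ℝ) ≤ (Real.log K + B * (2 * r) - Real.log ‖F c‖) / Real.log 2 := by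
  classical
  set C : ℂ := (c : ℂ) with hCdef
  set M : ℝ := K * Real.exp (B * (2 * r)) with hMdef
  have hK0 : 0 < K := lt_of_lt_of_le one_pos hK
  have hM1 : 1 ≤ M := by
    have h1 : (1 : ℝ) ≤ Real.exp (B * (2 * r)) := Real.one_le_exp (by positivity)
    nlinarith
  have h1 : 0 < |r| := by rwa [abs_of_pos hr]
  have h2 : |r| < |2 * r| := by
    rw [abs_of_pos hr, abs_of_pos (by linarith)]; linarith
  have h3 : AnalyticOnNhd ℂ F (closedBall C |2 * r|) := fun z _ ↦ hF.analyticAt z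
  have hcC : F C ≠ 0 := hc
  have h4 : ∀ z ∈ sphere C |2 * r|, ‖F z‖ ≤ M := by
    intro z hz
    rw [abs_of_pos (by linarith : (0 : ℝ) < 2 * r), mem_sphere, dist_eq_norm] at hz
    have him : |z.im| ≤ 2 * r := by
      have h := abs_im_le_norm (z - C)
      simp only [sub_im, hCdef, ofReal_im, sub_zero] at h
      linarith
    refine (hbound z).trans ?_
    rw [hMdef]
    exact mul_le_mul_of_nonneg_left (Real.exp_le_exp.mpr (mul_le_mul_of_nonneg_left him hB))
      hK0.le
  have hJ := AnalyticOnNhd.sum_divisor_le h1 h2 hM1 h3 hcC h4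
  rw [abs_of_pos hr] at hJ
  -- the number of zeros in `S` is at most the Jensen count
  set D := divisor F (closedBall C r) with hD
  have hanR : AnalyticOnNhd ℂ F (closedBall C r) := fun z _ ↦ hF.analyticAt z
  have hD0 : ∀ u, 0 ≤ D u := fun u ↦ hanR.divisor_nonneg u
  have hfin : (Function.support D).Finite := D.finiteSupport (isCompact_closedBall C r)
  set S' : Finset ℂ := S.image (fun x : ℝ ↦ (x : ℂ)) with hS'
  have hcard : S'.card = S.card :=
    Finset.card_image_of_injective _ Complex.ofReal_injective
  have hone : ∀ u ∈ S', 1 ≤ D u := by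
    intro u hu
    obtain ⟨x, hx, rfl⟩ := Finset.mem_image.mp hu
    obtain ⟨hxc, hx0⟩ := hS x hx
    refine one_le_divisor_of_zero hF hcC ?_ hx0
    rw [mem_closedBall, dist_eq_norm, hCdef, ← ofReal_sub, norm_real, Real.norm_eq_abs]
    exact hxc
  have hle : (S.card : ℤ) ≤ ∑ᶠ u, D u := by
    rw [finsum_eq_sum_of_support_subset D (s := hfin.toFinset ∪ S') (by intro u hu; simp [hu])]
    calc (S.card : ℤ) = ∑ _u ∈ S', (1 : ℤ) := by simp [hcard]
      _ ≤ ∑ u ∈ S', D u := Finset.sum_le_sum hone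
      _ ≤ ∑ u ∈ hfin.toFinset ∪ S', D u :=
          Finset.sum_le_sum_of_subset_of_nonneg Finset.subset_union_right fun u _ _ ↦ hD0 u
  have hle' : (S.card : ℝ) ≤ ((∑ᶠ u, D u : ℤ) : ℝ) := by exact_mod_cast hle
  refine hle'.trans (hJ.trans (le_of_eq ?_))
  have hFc : 0 < ‖F C‖ := norm_pos_iff.mpr hcC
  have hM0 : 0 < M := lt_of_lt_of_le one_pos hM1
  rw [Real.log_div hM0.ne' hFc.ne', hMdef, Real.log_mul hK0.ne' (Real.exp_pos _).ne',
    Real.log_exp]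
  congr 1
  rw [mul_div_assoc, div_self hr.ne', mul_one]

end Summit.RiemannHypothesis.RiemannHypothesis.Theorems.WeilWindowFlowStrictUnderRH

end
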